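import Summits.HodgeConjecture.HodgeConjecture.Theorems.F0P2oLineWeilDictionaryFrameTransportOfRecord  -- ★ p837171 A-p01 (g19): `frameOp_omegaLoc_chiLocalSplittingsCM` (pair side), `frameOp_lineWeilCM` (line side)
import Summits.HodgeConjecture.HodgeConjecture.Theorems.F0P2oThetaTypeJacquetLetterAOfDictionary     -- ★ p835111 A-p12 (g17): the letter-(a) tokens (`cmBorelTriple`, `localDet`, `glDiagonal`, …)
import Summits.HodgeConjecture.HodgeConjecture.Theorems.F0P2oLineWeilDictionaryCongruenceChangeExists  -- ★ p837965 A-p01 (g19): (CC-2) `exists_unitary_conj_of_formCongr`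
import HarnessLib

/-!
# F0 · P2 · N3 (a)-road, hand (C6): the LINE-JACQUET INTERTWINER (N′) TRANSPORTS ALONG FRAME INTERTWINERS — generic lemma + the rational-frame instance of record

Summit `HodgeConjecture`, sub-problem `HodgeConjecture`, crux H413 (`stmt-HodgeConjecture-24833`); programme F0∕P2, the N3 (#96
`GelbartRogawski1991.thetaType_nonsplit_jacquetModule`) clause-(a) road of lead B-p18 (g29) (`F0/P2/B-p18/g29/N3-ROAD.v3.B-p18g29.md`), hand (C6)
«TRANSPORT block frame → the letter's `(dV, T, e₁)`» (B-p18 (g29) 2026-08-31T23:27:34Z); seat B-p14 (g29).  THEOREMS ONLY (no `def`, no instance, no notation,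
no named fact, no `sorry`); kernel lane `--supports stmt-HodgeConjecture-24833 --as helper`.

WHAT.  F0P2-p06 (g4)'s η-free assembler `F0P2oN3OfLineJacquet.thetaType_nonsplit_jacquetModule_of_lineJacquet` reduces N3 to ONE statement (N′) per frame
`(L, e₁, dV, e₀, μ, v, ε, T)`: «there is a linear isomorphism `Tr : r_N(Ω) ≃ 𝒮(Fin n₀ → L⁺_v)` carrying the Jacquet action of every line torus element `t = diag(1, det u, 1)`
to GR's `ω¹(u)`» [GelbartRogawski1991, §3.2 (3.2.1) p. 457], where `Ω = ω_v ∘ localLineInl ∘ localPiEquiv⁻¹ ∘ ch_T` is the local Weil representation of record read on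
`U(Φ₃)(L⁺_v)` through the chart `ch_T = cmDatumLocalCongr L v T ha h`.  The lead proves (N′) at ONE block-adapted frame per `dV` ((C1)–(C5)); this file moves it to every
frame:
* §1 `lineJacquet_transport` — GENERIC: an (N′)-shaped intertwiner for `(ρ, Lr)` yields one for `(ρ′, Lr′)` whenever `ρ′ ≃ ρ` as `G`-representations (`Φ`) and
  `Lr′ ≃ Lr` as `U`-representations (`Φ₁`); the torus clause `R u m` is untouched (it lives in `G`), `Tr′ := Φ₁⁻¹ ∘ Tr ∘ r_N(Φ)` with `r_N(Φ)` the Jacquet functor on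
  the intertwining equivalence (★ `Representation.jacquetMap`, Mathlib `Coinvariants.map`), built inside the proof.
* §2 `lineJacquet_frameTransport_ofRecord` — THE RATIONAL-FRAME INSTANCE for the packages of record: `Pᵀ·diag(dV)·P = diag(dV′)` (`P ∈ GL₃(L⁺)`), `P·T′ = T`;
  (N′) at `(dV′, T′, e₁)` ⇒ (N′) at `(dV, T, e₁)`, p06's `hTr` binder type token for token on both sides.  Intertwiners BY NAME: pair side ★ A-p01 (g19)
  `frameOp_omegaLoc_chiLocalSplittingsCM` ((FN) (U) of B-p08 (g24) at the pair Gram) with ★ `frameConj_localPiEquiv_symm_cmDatumLocalCongr` ∕ ★ `frameConj_localLineInl`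
  (`frameConj_{P⊗1} ∘ ch′ = ch`), line side ★ `frameOp_lineWeilCM` (frame `det P ⊗ 1`, SAME `u`).

* §3 `lineJacquet_congruenceChange_of_formCongr` — THE CONGRUENCE CHANGE on a fixed `diag(dV)`: two form congruences `(T₀, a₀)`, `(T, a)` of `diag(dV)` onto `Φ₃`
  differ by `λ·k` with `k ∈ U(Φ₃)(L⁺_v)` unitary (★ A-p01 (g19) (CC-2) `exists_unitary_conj_of_formCongr`: `ch_T u = ch_{T₀}(k u k⁻¹)`), so `Ω_T = Ω_{T₀} ∘ Ad(k)` and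
  `Φ := Ω_{T₀}(k⁻¹)` is a `G`-intertwiner `Ω_T → Ω_{T₀}`; (N′) at `(dV, T₀, e₁)` ⇒ (N′) at `(dV, T, e₁)` by §1 with `Φ₁ := id`.

NOT HERE: the enumeration change `e₁ ↔ e_std` ((J4); §1 at a permutation frame, on the lead's word).  HC_CM is proved only modulo the printed citations (2 remaining named inputs hLiu418, h413) until
rung 0 closes; this file is count-neutral ((a)-road plumbing).

## References
* [GelbartRogawski1991] S. Gelbart, J. Rogawski, *L-functions and Fourier–Jacobi coefficients for the unitary group U(3)*, Invent. Math. 105 (1991), §3.2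
  (3.2.1)–(3.2.3) p. 457, §5.2 p. 467.
* [BernsteinZelevinsky1976] I. N. Bernstein, A. V. Zelevinsky, *Representations of the group GL(n, F) where F is a non-archimedean local field*, Russian Math.
  Surveys 31 (1976), §2.30 (functoriality of coinvariants).
* [MoeglinVignerasWaldspurger1987] C. Mœglin, M.-F. Vignéras, J.-L. Waldspurger, LNM 1291 (1987), Chap. 2 II Remarque (3) (transport of the Weil representation
  along isometries).
-/

set_option autoImplicit false

noncomputable section

open NumberField IsDedekindDomain Matrix MeasureTheory
open scoped MatrixGroups Kronecker
open Literature.NumberTheory.Automorphic Literature.NumberTheory.Automorphic.UnitaryGroup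
open Literature.NumberTheory.GelbartRogawski1991 Literature.NumberTheory.GelbartRogawski1991.UnitaryDualPair
open Literature.NumberTheory.GelbartRogawski1991.UnitaryDualPair.LocalSplitting Literature.NumberTheory.GelbartRogawski1991.UnitaryDualPair.WeilCoinv
open Literature.NumberTheory.GelbartRogawski1991.GRConstruction
open Literature.NumberTheory.Automorphic.IdeleClassGroup
open Literature.NumberTheory.Automorphic.Liu2021 Literature.NumberTheory.Automorphic.Liu2021.Def411WeilCarriers
open Literature.NumberTheory.Automorphic.Liu2021.Def411WeilCarriersDoubling
open Literature.RepresentationTheory Literature.RepresentationTheory.HeisenbergGroup Literature.RepresentationTheory.Liu2021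
open Literature.NumberTheory.GaloisRepresentations Literature.RepresentationTheory.HarrisKudlaSweet1996
open Literature.NumberTheory.Rogawski1990 Literature.NumberTheory

-- the mandated namespace has the single-problem summit's repeated segment (`HodgeConjecture.HodgeConjecture`)
set_option linter.dupNamespace false

namespace Summit.HodgeConjecture.HodgeConjecture.Cruxes.H413.F0P2oLineJacquetFrameTransport

open Summit.HodgeConjecture.HodgeConjecture.Cruxes.H413.F0P2oLineWeilDictionaryFrameTransport
open Summit.HodgeConjecture.HodgeConjecture.Cruxes.H413.F0P2oLineWeilDictionaryFrameTransportOfRecord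
open Summit.HodgeConjecture.HodgeConjecture.Cruxes.H413.F0P2oLineWeilDictionaryCongruenceChangeExists

/-! ## §1 GENERIC: an (N′)-shaped line-Jacquet intertwiner transports along a `G`-intertwining equivalence and a `U`-intertwining equivalence -/

section Generic

open Representation

variable {k : Type*} [CommRing k] {G U : Type*} [Group G] [Group U]
  {S S' M₁ M₁' : Type*} [AddCommGroup S] [Module k S] [AddCommGroup S'] [Module k S']
  [AddCommGroup M₁] [Module k M₁] [AddCommGroup M₁'] [Module k M₁']

/-- **Functoriality of the Jacquet module on an intertwining EQUIVALENCE** (stated as an `∃`, no new definition): for `Φ : S′ ≃ S` with `Φ ∘ ρ′(g) = ρ(g) ∘ Φ`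
there is a linear equivalence `J : r_N(ρ′) ≃ r_N(ρ)` with `J [x] = [Φ x]`; it is then automatically `M`-equivariant (`J ∘ r_N(ρ′)(m) = r_N(ρ)(m) ∘ J`).
(★ `Representation.jacquetMap` on `Φ` and on `Φ⁻¹`, Mathlib `Coinvariants.map`.) [cite: BernsteinZelevinsky1976, §2.30] -/
theorem exists_jacquet_equiv (ρ : Representation k G S) (ρ' : Representation k G S') (Φ : S' ≃ₗ[k] S) (hΦ : ∀ g f, Φ (ρ' g f) = ρ g (Φ f))
    (t : ParabolicTriple G) :
    ∃ J : (t.restrict ρ').Coinvariants ≃ₗ[k] (t.restrict ρ).Coinvariants,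
      (∀ x, J (Coinvariants.mk (t.restrict ρ') x) = Coinvariants.mk (t.restrict ρ) (Φ x)) ∧
        ∀ (m : t.M) (y : (t.restrict ρ').Coinvariants), J (ρ'.jacquetModule t m y) = ρ.jacquetModule t m (J y) := by
  -- `Φ` and `Φ⁻¹` as intertwining maps of the `G`-representations
  let φ : ρ'.IntertwiningMap ρ := ⟨(Φ : S' →ₗ[k] S), fun g => by ext v; exact hΦ g v⟩
  have hΦ' : ∀ g f, Φ.symm (ρ g f) = ρ' g (Φ.symm f) := fun g f => by
    apply Φ.injective
    rw [hΦ, LinearEquiv.apply_symm_apply, LinearEquiv.apply_symm_apply]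
  let ψ : ρ.IntertwiningMap ρ' := ⟨(Φ.symm : S →ₗ[k] S'), fun g => by ext v; exact hΦ' g v⟩
  -- the two Jacquet maps are mutually inverse
  have h1 : (jacquetMap t ψ).toLinearMap ∘ₗ (jacquetMap t φ).toLinearMap = LinearMap.id := by
    refine Coinvariants.hom_ext ?_
    ext x
    simp only [LinearMap.coe_comp, Function.comp_apply, IntertwiningMap.coe_toLinearMap, LinearMap.id_comp]
    rw [jacquetMap_mk, jacquetMap_mk]
    change Coinvariants.mk _ (Φ.symm (Φ x)) = _
    rw [LinearEquiv.symm_apply_apply]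
  have h2 : (jacquetMap t φ).toLinearMap ∘ₗ (jacquetMap t ψ).toLinearMap = LinearMap.id := by
    refine Coinvariants.hom_ext ?_
    ext x
    simp only [LinearMap.coe_comp, Function.comp_apply, IntertwiningMap.coe_toLinearMap, LinearMap.id_comp]
    rw [jacquetMap_mk, jacquetMap_mk]
    change Coinvariants.mk _ (Φ (Φ.symm x)) = _
    rw [LinearEquiv.apply_symm_apply]
  refine ⟨LinearEquiv.ofLinear (jacquetMap t φ).toLinearMap (jacquetMap t ψ).toLinearMap h2 h1, fun x => ?_, fun m y => ?_⟩
  · rfl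
  · change jacquetMap t φ (ρ'.jacquetModule t m y) = ρ.jacquetModule t m (jacquetMap t φ y)
    exact IntertwiningMap.isIntertwining _ _ (jacquetMap t φ) m y

/-- **GENERIC TRANSPORT OF AN (N′)-SHAPED LINE-JACQUET INTERTWINER.**  Data: `ρ, ρ′` representations of `G` on `S, S′` intertwined by `Φ : S′ ≃ S`
(`Φ ∘ ρ′(g) = ρ(g) ∘ Φ`); a parabolic triple `t = (P, M, N)` of `G`; `Lr, Lr′` representations of `U` on `M₁, M₁′` intertwined by `Φ₁ : M₁′ ≃ M₁`; a torus
clause `R : U → M → Prop` (in the application: «`diag(1, det u, 1) = m`», a statement inside `G`, untouched by the transport).  If some `Tr : r_N(ρ) ≃ M₁` satisfies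
`Tr (r_N(ρ)(m) x) = Lr(u) (Tr x)` whenever `R u m`, then `Tr′ := Φ₁⁻¹ ∘ Tr ∘ r_N(Φ) : r_N(ρ′) ≃ M₁′` satisfies `Tr′ (r_N(ρ′)(m) x) = Lr′(u) (Tr′ x)` whenever `R u m`.
[cite: BernsteinZelevinsky1976, §2.30] [cite: MoeglinVignerasWaldspurger1987, Chap. 2 II Remarque (3)] -/
theorem lineJacquet_transport (ρ : Representation k G S) (ρ' : Representation k G S') (Φ : S' ≃ₗ[k] S) (hΦ : ∀ g f, Φ (ρ' g f) = ρ g (Φ f))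
    (t : ParabolicTriple G)
    (Lr : Representation k U M₁) (Lr' : Representation k U M₁') (Φ₁ : M₁' ≃ₗ[k] M₁) (hΦ₁ : ∀ u m, Φ₁ (Lr' u m) = Lr u (Φ₁ m))
    (R : U → t.M → Prop)
    (h : ∃ Tr : (t.restrict ρ).Coinvariants ≃ₗ[k] M₁, ∀ (u : U) (m : t.M), R u m → ∀ x, Tr (ρ.jacquetModule t m x) = Lr u (Tr x)) :
    ∃ Tr' : (t.restrict ρ').Coinvariants ≃ₗ[k] M₁', ∀ (u : U) (m : t.M), R u m → ∀ x, Tr' (ρ'.jacquetModule t m x) = Lr' u (Tr' x) := by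
  obtain ⟨Tr, hTr⟩ := h
  obtain ⟨J, -, hJ⟩ := exists_jacquet_equiv ρ ρ' Φ hΦ t
  refine ⟨(J.trans Tr).trans Φ₁.symm, fun u m hum x => ?_⟩
  apply Φ₁.injective
  rw [LinearEquiv.trans_apply, LinearEquiv.trans_apply, LinearEquiv.apply_symm_apply, hJ, hTr u m hum, hΦ₁,
    LinearEquiv.trans_apply, LinearEquiv.trans_apply, LinearEquiv.apply_symm_apply]

end Generic

/-! ## §2 THE RATIONAL-FRAME INSTANCE OF RECORD: (N′) at `(dV′, T′ = P⁻¹T, e₁)` ⇒ (N′) at `(dV, T, e₁)` -/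

section OfRecord

variable (L : Type) [Field L] [NumberField L] [IsCMField L] (v : HeightOneSpectrum (𝓞 ↥(maximalRealSubfield L)))
  (dV dV' : Fin 3 → L) (hdV : ∀ i, IsCMField.complexConj L (dV i) = dV i) (hdV' : ∀ i, IsCMField.complexConj L (dV' i) = dV' i)
  (P : GL (Fin 3) ↥(maximalRealSubfield L))
  (hP : (P : Matrix (Fin 3) (Fin 3) ↥(maximalRealSubfield L))ᵀ * realDiagonal L dV hdV * (P : Matrix (Fin 3) (Fin 3) ↥(maximalRealSubfield L)) =
    realDiagonal L dV' hdV')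
  {n' : ℕ} (e₁ : Fin 3 × Fin 1 ≃ Fin n') (hdV0 : ∀ i, dV i ≠ 0) (hdV0' : ∀ i, dV' i ≠ 0) (ε : (↥(maximalRealSubfield L))ˣ)

include hP in
set_option synthInstance.maxHeartbeats 400000 in
set_option maxHeartbeats 8000000 in
/-- **(C6) THE LINE-JACQUET INTERTWINER (N′) TRANSPORTS ALONG A RATIONAL FRAME — PACKAGES OF RECORD.**  For `P ∈ GL₃(L⁺)` with `Pᵀ diag(dV) P = diag(dV′)` and
`P · T′ = T`: if the local Weil representation of record at `(dV′, ε)`, read on `U(Φ₃)(L⁺_v)` through the chart `ch_{T′}`, admits a line-Jacquet intertwiner `Tr′`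
(F0P2-p06 (g4)'s `hTr` binder at `(dV′, T′, e₁)`, token for token), then so does the one at `(dV, ε)` read through `ch_T` (the same binder at `(dV, T, e₁)`).
`Tr := frameOp_{det P ⊗ 1} ∘ Tr′ ∘ r_N(frameOp_{P ⊗ 1}⁻¹)`: §1 at the pair-side intertwiner ★ `frameOp_omegaLoc_chiLocalSplittingsCM` (A-p01 (g19); (FN) (U) of B-p08 (g24))
composed with ★ `frameConj_localLineInl` ∕ ★ `frameConj_localPiEquiv_symm_cmDatumLocalCongr` (`frameConj_{P⊗1} ∘ ch′ = ch`), and the line-side intertwiner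
★ `frameOp_lineWeilCM` (same `u`).  The torus clause `diag(1, det u, 1) = t` is a statement in `U(Φ₃)(L⁺_v)` and is not moved.
[cite: GelbartRogawski1991, §3.2 (3.2.1)–(3.2.2) p. 457] [cite: MoeglinVignerasWaldspurger1987, Chap. 2 II Remarque (3)] [cite: BernsteinZelevinsky1976, §2.30] -/
theorem lineJacquet_frameTransport_ofRecord {n₀ : ℕ} (e₀ : Fin 1 × Fin 1 ≃ Fin n₀)
    (μ : Literature.NumberTheory.Automorphic.IdeleClassGroup L →ₜ* Circle) (hμ : IsConjugateSymplectic L μ)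
    (T : GL (Fin 3) (LocalRing L v)) {a : LocalRing L v} (ha : IsUnit a)
    (h : formCongr (conjLocal L (IsCMField.complexConj L) v) T ((Matrix.diagonal dV).map (algebraMap L (LocalRing L v))) =
      a • (Matrix.of fun i j : Fin 3 => if i.val + j.val + 1 = 3 then (1 : L) else 0).map (algebraMap L (LocalRing L v)))
    (T' : GL (Fin 3) (LocalRing L v)) (hT' : FrameTransport.framePloc (↥(maximalRealSubfield L)) L v 3 P * T' = T) {a' : LocalRing L v} (ha' : IsUnit a')
    (h' : formCongr (conjLocal L (IsCMField.complexConj L) v) T' ((Matrix.diagonal dV').map (algebraMap L (LocalRing L v))) =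
      a' • (Matrix.of fun i j : Fin 3 => if i.val + j.val + 1 = 3 then (1 : L) else 0).map (algebraMap L (LocalRing L v)))
    (hN' : ∃ Tr' : ((cmBorelTriple L 3 v).restrict
      (((chiLocalSplittingsCM L e₁ dV' hdV' hdV0' (toHeckeCharacter L μ) ((isOscillatorChar_toHeckeCharacter_iff μ).mpr hμ) ε).omegaLoc v).comp
        ((localLineInl L (IsCMField.complexConj L) 3 e₁ (Matrix.diagonal dV') (JW (↥(maximalRealSubfield L)) L ε) v).comp
          ((localPiEquiv L (IsCMField.complexConj L) 3 (Matrix.diagonal dV') v).symm.toMonoidHom.comp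
            (cmDatumLocalCongr L v T' ha' h').toMonoidHom)))).Coinvariants ≃ₗ[ℂ]
      SchwartzBruhat (Fin n₀ → v.adicCompletion ↥(maximalRealSubfield L)),
      ∀ (u : localPi L (IsCMField.complexConj L) 1 (JW (↥(maximalRealSubfield L)) L ε) v) (t : ↥(cmBorelTriple L 3 v).M),
        glDiagonal 3 (LocalRing L v) ![1, ((localDet (IsCMField.complexConj L) v
          (isUnit_iff_ne_zero.mpr (by rw [Matrix.det_fin_one]; exact JW_apply_ne_zero (↥(maximalRealSubfield L)) L ε))
          (localPiEquiv L (IsCMField.complexConj L) 1 (JW (↥(maximalRealSubfield L)) L ε) v u) :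
            ↥(normOneUnits (conjLocal L (IsCMField.complexConj L) v))) : (LocalRing L v)ˣ), 1] =
          ((t : ↥(unitaryGroupOfForm (conjLocal L (IsCMField.complexConj L) v) (cmLocalForm L 3 v))) : GL (Fin 3) (LocalRing L v)) →
        ∀ x, Tr' (Representation.jacquetModule
          (((chiLocalSplittingsCM L e₁ dV' hdV' hdV0' (toHeckeCharacter L μ) ((isOscillatorChar_toHeckeCharacter_iff μ).mpr hμ) ε).omegaLoc v).comp
            ((localLineInl L (IsCMField.complexConj L) 3 e₁ (Matrix.diagonal dV') (JW (↥(maximalRealSubfield L)) L ε) v).comp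
              ((localPiEquiv L (IsCMField.complexConj L) 3 (Matrix.diagonal dV') v).symm.toMonoidHom.comp
                (cmDatumLocalCongr L v T' ha' h').toMonoidHom)))
          (cmBorelTriple L 3 v) t x) =
          lineWeilCM L e₀ (kernelLineCM dV') (complexConj_kernelLineCM dV' hdV') (kernelLineCM_ne_zero dV' hdV0') μ hμ ε v u (Tr' x)) :
    ∃ Tr : ((cmBorelTriple L 3 v).restrict
      (((chiLocalSplittingsCM L e₁ dV hdV hdV0 (toHeckeCharacter L μ) ((isOscillatorChar_toHeckeCharacter_iff μ).mpr hμ) ε).omegaLoc v).comp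
        ((localLineInl L (IsCMField.complexConj L) 3 e₁ (Matrix.diagonal dV) (JW (↥(maximalRealSubfield L)) L ε) v).comp
          ((localPiEquiv L (IsCMField.complexConj L) 3 (Matrix.diagonal dV) v).symm.toMonoidHom.comp
            (cmDatumLocalCongr L v T ha h).toMonoidHom)))).Coinvariants ≃ₗ[ℂ]
      SchwartzBruhat (Fin n₀ → v.adicCompletion ↥(maximalRealSubfield L)),
      ∀ (u : localPi L (IsCMField.complexConj L) 1 (JW (↥(maximalRealSubfield L)) L ε) v) (t : ↥(cmBorelTriple L 3 v).M),
        glDiagonal 3 (LocalRing L v) ![1, ((localDet (IsCMField.complexConj L) v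
          (isUnit_iff_ne_zero.mpr (by rw [Matrix.det_fin_one]; exact JW_apply_ne_zero (↥(maximalRealSubfield L)) L ε))
          (localPiEquiv L (IsCMField.complexConj L) 1 (JW (↥(maximalRealSubfield L)) L ε) v u) :
            ↥(normOneUnits (conjLocal L (IsCMField.complexConj L) v))) : (LocalRing L v)ˣ), 1] =
          ((t : ↥(unitaryGroupOfForm (conjLocal L (IsCMField.complexConj L) v) (cmLocalForm L 3 v))) : GL (Fin 3) (LocalRing L v)) →
        ∀ x, Tr (Representation.jacquetModule
          (((chiLocalSplittingsCM L e₁ dV hdV hdV0 (toHeckeCharacter L μ) ((isOscillatorChar_toHeckeCharacter_iff μ).mpr hμ) ε).omegaLoc v).comp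
            ((localLineInl L (IsCMField.complexConj L) 3 e₁ (Matrix.diagonal dV) (JW (↥(maximalRealSubfield L)) L ε) v).comp
              ((localPiEquiv L (IsCMField.complexConj L) 3 (Matrix.diagonal dV) v).symm.toMonoidHom.comp
                (cmDatumLocalCongr L v T ha h).toMonoidHom)))
          (cmBorelTriple L 3 v) t x) =
          lineWeilCM L e₀ (kernelLineCM dV) (complexConj_kernelLineCM dV hdV) (kernelLineCM_ne_zero dV hdV0) μ hμ ε v u (Tr x) := by
  -- §1 with `ρ := Ω_{dV,T}`, `ρ′ := Ω_{dV′,T′}`, `Φ := frameOp_{P ⊗ 1}⁻¹`-oriented: we transport FROM `(dV′, T′)` TO `(dV, T)`, so the `G`-intertwiner is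
  -- `Φ := (frameOp_{P⊗1})⁻¹ : 𝒮 ≃ 𝒮` from the `(dV, T)`-model to the `(dV′, T′)`-model and the line intertwiner is `Φ₁ := (frameOp_{det P ⊗ 1})⁻¹`.
  refine lineJacquet_transport
    (((chiLocalSplittingsCM L e₁ dV' hdV' hdV0' (toHeckeCharacter L μ) ((isOscillatorChar_toHeckeCharacter_iff μ).mpr hμ) ε).omegaLoc v).comp
      ((localLineInl L (IsCMField.complexConj L) 3 e₁ (Matrix.diagonal dV') (JW (↥(maximalRealSubfield L)) L ε) v).comp
        ((localPiEquiv L (IsCMField.complexConj L) 3 (Matrix.diagonal dV') v).symm.toMonoidHom.comp (cmDatumLocalCongr L v T' ha' h').toMonoidHom)))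
    (((chiLocalSplittingsCM L e₁ dV hdV hdV0 (toHeckeCharacter L μ) ((isOscillatorChar_toHeckeCharacter_iff μ).mpr hμ) ε).omegaLoc v).comp
      ((localLineInl L (IsCMField.complexConj L) 3 e₁ (Matrix.diagonal dV) (JW (↥(maximalRealSubfield L)) L ε) v).comp
        ((localPiEquiv L (IsCMField.complexConj L) 3 (Matrix.diagonal dV) v).symm.toMonoidHom.comp (cmDatumLocalCongr L v T ha h).toMonoidHom)))
    (FrameTransport.frameOp (↥(maximalRealSubfield L)) v n' (UnitaryGroup.reindexGL e₁ (kroneckerGL (P, 1)))).symm ?_ (cmBorelTriple L 3 v)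
    (lineWeilCM L e₀ (kernelLineCM dV') (complexConj_kernelLineCM dV' hdV') (kernelLineCM_ne_zero dV' hdV0') μ hμ ε v)
    (lineWeilCM L e₀ (kernelLineCM dV) (complexConj_kernelLineCM dV hdV) (kernelLineCM_ne_zero dV hdV0) μ hμ ε v)
    (FrameTransport.frameOp (↥(maximalRealSubfield L)) v n₀
      (UnitaryGroup.reindexGL e₀ (kroneckerGL (Units.map (Matrix.scalar (Fin 1)).toMonoidHom (Matrix.GeneralLinearGroup.det P), 1)))).symm ?_ _ hN'
  · -- pair side: `frameOp⁻¹ (Ω_{dV,T} g f) = Ω_{dV′,T′} g (frameOp⁻¹ f)` from ★ `frameOp_omegaLoc_chiLocalSplittingsCM` + the chart identities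
    intro g f
    apply (FrameTransport.frameOp (↥(maximalRealSubfield L)) v n' (UnitaryGroup.reindexGL e₁ (kroneckerGL (P, 1)))).injective
    rw [LinearEquiv.apply_symm_apply]
    dsimp only [FinLocalSplittings.omegaLoc]
    simp only [MonoidHom.comp_apply]
    rw [frameOp_omegaLoc_chiLocalSplittingsCM L v dV dV' hdV hdV' P hP e₁ hdV0 hdV0' ε, LinearEquiv.apply_symm_apply,
      frameConj_localLineInl L (IsCMField.complexConj L) 3 e₁ v (realDiagonal_map L dV hdV).symm (realDiagonal_map L dV' hdV').symm P hP
        (TW (↥(maximalRealSubfield L)) ε) (JW_eq (↥(maximalRealSubfield L)) L ε)]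
    exact congrArg (fun x => MpPsi.toRep (localSchrodinger (↥(maximalRealSubfield L)) n'
        (UnitaryDualPair.gram (↥(maximalRealSubfield L)) e₁ (realDiagonal L dV hdV) (TW (↥(maximalRealSubfield L)) ε)) v)
        ((chiLocalSplittingsCM L e₁ dV hdV hdV0 (toHeckeCharacter L μ) ((isOscillatorChar_toHeckeCharacter_iff μ).mpr hμ) ε).s v
          (localLineInl L (IsCMField.complexConj L) 3 e₁ (Matrix.diagonal dV) (JW (↥(maximalRealSubfield L)) L ε) v x)) f)
      (frameConj_localPiEquiv_symm_cmDatumLocalCongr L v dV dV' hdV hdV' P hP T ha h T' hT' ha' h' (g : Gqs L v)).symm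
  · -- line side: `frameOp⁻¹ (ω¹_{dV} u m) = ω¹_{dV′} u (frameOp⁻¹ m)` from ★ `frameOp_lineWeilCM`
    intro u m
    apply (FrameTransport.frameOp (↥(maximalRealSubfield L)) v n₀
      (UnitaryGroup.reindexGL e₀ (kroneckerGL (Units.map (Matrix.scalar (Fin 1)).toMonoidHom (Matrix.GeneralLinearGroup.det P), 1)))).injective
    rw [LinearEquiv.apply_symm_apply, frameOp_lineWeilCM L v dV dV' hdV hdV' P hP hdV0 hdV0' ε e₀ μ hμ, LinearEquiv.apply_symm_apply]

end OfRecord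

/-! ## §3 THE CONGRUENCE CHANGE on a fixed `diag(dV)`: (N′) at `(dV, T₀, e₁)` ⇒ (N′) at `(dV, T, e₁)` -/

section CongruenceChange

variable (L : Type) [Field L] [NumberField L] [IsCMField L] (v : HeightOneSpectrum (𝓞 ↥(maximalRealSubfield L)))
  (dV : Fin 3 → L) (hdV : ∀ i, IsCMField.complexConj L (dV i) = dV i)
  (T₀ : GL (Fin 3) (LocalRing L v)) {a₀ : LocalRing L v} (ha₀ : IsUnit a₀)
  (h₀ : formCongr (conjLocal L (IsCMField.complexConj L) v) T₀ ((Matrix.diagonal dV).map (algebraMap L (LocalRing L v))) =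
    a₀ • (Matrix.of fun i j : Fin 3 => if i.val + j.val + 1 = 3 then (1 : L) else 0).map (algebraMap L (LocalRing L v)))
  (T : GL (Fin 3) (LocalRing L v)) {a : LocalRing L v} (ha : IsUnit a)
  (h : formCongr (conjLocal L (IsCMField.complexConj L) v) T ((Matrix.diagonal dV).map (algebraMap L (LocalRing L v))) =
    a • (Matrix.of fun i j : Fin 3 => if i.val + j.val + 1 = 3 then (1 : L) else 0).map (algebraMap L (LocalRing L v)))

set_option synthInstance.maxHeartbeats 400000 in
set_option maxHeartbeats 8000000 in
/-- **(C6) THE LINE-JACQUET INTERTWINER (N′) IS INSENSITIVE TO THE CHOICE OF THE FORM CONGRUENCE.**  Two form congruences `(T₀, a₀)`, `(T, a)` of the same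
`diag(dV)` onto `Φ₃`: by ★ `exists_unitary_conj_of_formCongr` (A-p01 (g19), odd rank `GU(Φ₃) = E^× · U(Φ₃)`) there is `k ∈ U(Φ₃)(L⁺_v)` with
`ch_T u = ch_{T₀} (k u k⁻¹)`, hence `Ω_T(g) = Ω_{T₀}(k) Ω_{T₀}(g) Ω_{T₀}(k)⁻¹` and `Φ := Ω_{T₀}(k⁻¹)` intertwines `Ω_T` with `Ω_{T₀}` as representations of `U(Φ₃)(L⁺_v)`;
§1 with `Φ₁ := id` carries a line-Jacquet intertwiner for `(dV, T₀, e₁)` (F0P2-p06 (g4)'s `hTr` binder, token for token) to one for `(dV, T, e₁)`.  The torus clause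
`diag(1, det u, 1) = t` is not moved. [cite: GelbartRogawski1991, §3.2 (3.2.1) p. 457] [cite: Rogawski1990, §1.9 p. 8; §14.2 p. 232] [cite: BernsteinZelevinsky1976, §2.30] -/
theorem lineJacquet_congruenceChange_of_formCongr (hdV0 : ∀ i, dV i ≠ 0) {n' : ℕ} (e₁ : Fin 3 × Fin 1 ≃ Fin n') (ε : (↥(maximalRealSubfield L))ˣ)
    {n₀ : ℕ} (e₀ : Fin 1 × Fin 1 ≃ Fin n₀)
    (μ : Literature.NumberTheory.Automorphic.IdeleClassGroup L →ₜ* Circle) (hμ : IsConjugateSymplectic L μ)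
    (hN₀ : ∃ Tr₀ : ((cmBorelTriple L 3 v).restrict
      (((chiLocalSplittingsCM L e₁ dV hdV hdV0 (toHeckeCharacter L μ) ((isOscillatorChar_toHeckeCharacter_iff μ).mpr hμ) ε).omegaLoc v).comp
        ((localLineInl L (IsCMField.complexConj L) 3 e₁ (Matrix.diagonal dV) (JW (↥(maximalRealSubfield L)) L ε) v).comp
          ((localPiEquiv L (IsCMField.complexConj L) 3 (Matrix.diagonal dV) v).symm.toMonoidHom.comp
            (cmDatumLocalCongr L v T₀ ha₀ h₀).toMonoidHom)))).Coinvariants ≃ₗ[ℂ]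
      SchwartzBruhat (Fin n₀ → v.adicCompletion ↥(maximalRealSubfield L)),
      ∀ (u : localPi L (IsCMField.complexConj L) 1 (JW (↥(maximalRealSubfield L)) L ε) v) (t : ↥(cmBorelTriple L 3 v).M),
        glDiagonal 3 (LocalRing L v) ![1, ((localDet (IsCMField.complexConj L) v
          (isUnit_iff_ne_zero.mpr (by rw [Matrix.det_fin_one]; exact JW_apply_ne_zero (↥(maximalRealSubfield L)) L ε))
          (localPiEquiv L (IsCMField.complexConj L) 1 (JW (↥(maximalRealSubfield L)) L ε) v u) :
            ↥(normOneUnits (conjLocal L (IsCMField.complexConj L) v))) : (LocalRing L v)ˣ), 1] =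
          ((t : ↥(unitaryGroupOfForm (conjLocal L (IsCMField.complexConj L) v) (cmLocalForm L 3 v))) : GL (Fin 3) (LocalRing L v)) →
        ∀ x, Tr₀ (Representation.jacquetModule
          (((chiLocalSplittingsCM L e₁ dV hdV hdV0 (toHeckeCharacter L μ) ((isOscillatorChar_toHeckeCharacter_iff μ).mpr hμ) ε).omegaLoc v).comp
            ((localLineInl L (IsCMField.complexConj L) 3 e₁ (Matrix.diagonal dV) (JW (↥(maximalRealSubfield L)) L ε) v).comp
              ((localPiEquiv L (IsCMField.complexConj L) 3 (Matrix.diagonal dV) v).symm.toMonoidHom.comp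
                (cmDatumLocalCongr L v T₀ ha₀ h₀).toMonoidHom)))
          (cmBorelTriple L 3 v) t x) =
          lineWeilCM L e₀ (kernelLineCM dV) (complexConj_kernelLineCM dV hdV) (kernelLineCM_ne_zero dV hdV0) μ hμ ε v u (Tr₀ x)) :
    ∃ Tr : ((cmBorelTriple L 3 v).restrict
      (((chiLocalSplittingsCM L e₁ dV hdV hdV0 (toHeckeCharacter L μ) ((isOscillatorChar_toHeckeCharacter_iff μ).mpr hμ) ε).omegaLoc v).comp
        ((localLineInl L (IsCMField.complexConj L) 3 e₁ (Matrix.diagonal dV) (JW (↥(maximalRealSubfield L)) L ε) v).comp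
          ((localPiEquiv L (IsCMField.complexConj L) 3 (Matrix.diagonal dV) v).symm.toMonoidHom.comp
            (cmDatumLocalCongr L v T ha h).toMonoidHom)))).Coinvariants ≃ₗ[ℂ]
      SchwartzBruhat (Fin n₀ → v.adicCompletion ↥(maximalRealSubfield L)),
      ∀ (u : localPi L (IsCMField.complexConj L) 1 (JW (↥(maximalRealSubfield L)) L ε) v) (t : ↥(cmBorelTriple L 3 v).M),
        glDiagonal 3 (LocalRing L v) ![1, ((localDet (IsCMField.complexConj L) v
          (isUnit_iff_ne_zero.mpr (by rw [Matrix.det_fin_one]; exact JW_apply_ne_zero (↥(maximalRealSubfield L)) L ε))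
          (localPiEquiv L (IsCMField.complexConj L) 1 (JW (↥(maximalRealSubfield L)) L ε) v u) :
            ↥(normOneUnits (conjLocal L (IsCMField.complexConj L) v))) : (LocalRing L v)ˣ), 1] =
          ((t : ↥(unitaryGroupOfForm (conjLocal L (IsCMField.complexConj L) v) (cmLocalForm L 3 v))) : GL (Fin 3) (LocalRing L v)) →
        ∀ x, Tr (Representation.jacquetModule
          (((chiLocalSplittingsCM L e₁ dV hdV hdV0 (toHeckeCharacter L μ) ((isOscillatorChar_toHeckeCharacter_iff μ).mpr hμ) ε).omegaLoc v).comp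
            ((localLineInl L (IsCMField.complexConj L) 3 e₁ (Matrix.diagonal dV) (JW (↥(maximalRealSubfield L)) L ε) v).comp
              ((localPiEquiv L (IsCMField.complexConj L) 3 (Matrix.diagonal dV) v).symm.toMonoidHom.comp
                (cmDatumLocalCongr L v T ha h).toMonoidHom)))
          (cmBorelTriple L 3 v) t x) =
          lineWeilCM L e₀ (kernelLineCM dV) (complexConj_kernelLineCM dV hdV) (kernelLineCM_ne_zero dV hdV0) μ hμ ε v u (Tr x) := by
  obtain ⟨k, hk⟩ := exists_unitary_conj_of_formCongr L v dV hdV T₀ ha₀ h₀ T ha h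
  -- `Ω_{T₀}` as a representation of `U(Φ₃)(L⁺_v)`
  set ρ₀ : Representation ℂ (Gqs L v) (SchwartzBruhat (Fin n' → v.adicCompletion ↥(maximalRealSubfield L))) :=
    ((chiLocalSplittingsCM L e₁ dV hdV hdV0 (toHeckeCharacter L μ) ((isOscillatorChar_toHeckeCharacter_iff μ).mpr hμ) ε).omegaLoc v).comp
      ((localLineInl L (IsCMField.complexConj L) 3 e₁ (Matrix.diagonal dV) (JW (↥(maximalRealSubfield L)) L ε) v).comp
        ((localPiEquiv L (IsCMField.complexConj L) 3 (Matrix.diagonal dV) v).symm.toMonoidHom.comp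
          (cmDatumLocalCongr L v T₀ ha₀ h₀).toMonoidHom)) with hρ₀
  -- the chart identity at the element level and `Ω_T(g) = Ω_{T₀}(k g k⁻¹)`
  have hk' : ∀ u : Gqs L v, cmDatumLocalCongr L v T ha h u = cmDatumLocalCongr L v T₀ ha₀ h₀ (k * u * k⁻¹) := fun u => Subtype.ext (hk u)
  have hΩ : ∀ g : Gqs L v,
      (((chiLocalSplittingsCM L e₁ dV hdV hdV0 (toHeckeCharacter L μ) ((isOscillatorChar_toHeckeCharacter_iff μ).mpr hμ) ε).omegaLoc v).comp
        ((localLineInl L (IsCMField.complexConj L) 3 e₁ (Matrix.diagonal dV) (JW (↥(maximalRealSubfield L)) L ε) v).comp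
          ((localPiEquiv L (IsCMField.complexConj L) 3 (Matrix.diagonal dV) v).symm.toMonoidHom.comp
            (cmDatumLocalCongr L v T ha h).toMonoidHom))) g = ρ₀ (k * g * k⁻¹) := by
    intro g
    rw [hρ₀]
    simp only [MonoidHom.comp_apply]
    exact congrArg (fun x => ((chiLocalSplittingsCM L e₁ dV hdV hdV0 (toHeckeCharacter L μ) ((isOscillatorChar_toHeckeCharacter_iff μ).mpr hμ) ε).omegaLoc v)
      (localLineInl L (IsCMField.complexConj L) 3 e₁ (Matrix.diagonal dV) (JW (↥(maximalRealSubfield L)) L ε) v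
        ((localPiEquiv L (IsCMField.complexConj L) 3 (Matrix.diagonal dV) v).symm.toMonoidHom x))) (hk' g)
  -- `Φ := ρ₀(k⁻¹)` as a linear equivalence with inverse `ρ₀(k)`
  have h1 : (ρ₀ k⁻¹ : _ →ₗ[ℂ] _) ∘ₗ (ρ₀ k : _ →ₗ[ℂ] _) = LinearMap.id := by
    rw [← Module.End.mul_eq_comp, ← map_mul, inv_mul_cancel, map_one]; rfl
  have h2 : (ρ₀ k : _ →ₗ[ℂ] _) ∘ₗ (ρ₀ k⁻¹ : _ →ₗ[ℂ] _) = LinearMap.id := by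
    rw [← Module.End.mul_eq_comp, ← map_mul, mul_inv_cancel, map_one]; rfl
  refine lineJacquet_transport ρ₀ _ (LinearEquiv.ofLinear (ρ₀ k⁻¹) (ρ₀ k) h1 h2) ?_ (cmBorelTriple L 3 v)
    (lineWeilCM L e₀ (kernelLineCM dV) (complexConj_kernelLineCM dV hdV) (kernelLineCM_ne_zero dV hdV0) μ hμ ε v)
    (lineWeilCM L e₀ (kernelLineCM dV) (complexConj_kernelLineCM dV hdV) (kernelLineCM_ne_zero dV hdV0) μ hμ ε v)
    (LinearEquiv.refl ℂ _) (fun _ _ => rfl) _ (by rw [hρ₀]; exact hN₀)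
  intro g f
  refine (congrArg (fun φ : SchwartzBruhat (Fin n' → v.adicCompletion ↥(maximalRealSubfield L)) →ₗ[ℂ]
      SchwartzBruhat (Fin n' → v.adicCompletion ↥(maximalRealSubfield L)) => ρ₀ k⁻¹ (φ f)) (hΩ g)).trans ?_
  change ρ₀ k⁻¹ (ρ₀ (k * g * k⁻¹) f) = ρ₀ g (ρ₀ k⁻¹ f)
  rw [← Module.End.mul_apply, ← map_mul, ← Module.End.mul_apply, ← map_mul]
  congr 2
  group

end CongruenceChange

end Summit.HodgeConjecture.HodgeConjecture.Cruxes.H413.F0P2oLineJacquetFrameTransport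

end
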